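import Summits.Ventures.CertifiedArithmetic.Expansions.CompressRelativeErrorTwoTerm
import Literature.ComputerArithmetic.RumpZimmermannBoldoMelquiond2009.PredSucc
import Literature.ComputerArithmetic.MullerRideau2022.AccurateDWPlusDWSharpness
import Mathlib.Tactic.Linarith
import Mathlib.Tactic.Positivity
import Mathlib.Tactic.Ring
import Mathlib.Tactic.NormNum

/-!
# COMPRESS under ties-to-away can turn a NONADJACENT expansion into an ADJACENT one
# (new work; Theorem 23's "(nonadjacent if round-to-even is used)" is sharp in the tie rule)

New work of the certified-arithmetic venture (ENGINES group: shared numerical engines serving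
client cells; rigour lives in the verifiers; every published number belongs to a client cell's
ledger, not to the engines group).  NEGATIVE knowledge on the output contract of COMPRESS
[Shewchuk1997, §2.7 Theorem 23]: "h is a nonoverlapping expansion (nonadjacent if round-to-even
tiebreaking is used)".  The tree's `compress_spec` proves the nonadjacent conclusion for every
round-to-nearest whose roundoff lies 2-below the rounded value (`RoundoffBelow 2`, which
round-to-even has) and the nonoverlapping conclusion for every tie rule.  THIS FILE shows that
the parenthesis cannot be dropped: under IEEE 754-2008 roundTiesToAway (`IsTiesAway` of
`RumpZimmermannBoldoMelquiond2009.PredSucc`), in EVERY precision `p ≥ 2` and every binade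
`2^e₀`, `e₀ ≥ emin`,

  `COMPRESS ⟨2^e₀, 2^p·2^e₀⟩ = ⟨−2^e₀, (2^p + 2)·2^e₀⟩`        (`compress_pair_tiesAway`)

(`p = 3`, `e₀ = 0`: `⟨1, 8⟩ ↦ ⟨−1, 10⟩`).  The INPUT is a nonoverlapping and even
NONADJACENT expansion of floats; the OUTPUT is nonoverlapping (as Theorem 23 guarantees for any
tie rule) but ADJACENT: `2·|−2^e₀| = 2^(e₀+1)` is the last nonzero bit of
`(2^p + 2)·2^e₀ = (2^(p−1) + 1)·2^(e₀+1)` (`compress_tiesAway_adjacent`: `IsExpansion 2` fails,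
and in the words of §2.1 the two components are not `Nonadjacent`).  So a COMPRESS pass under
ties-to-away can DESTROY nonadjacency, whereas under round-to-even it creates it; the output
pair is moreover a fixed point of COMPRESS under ties-to-away (`compress_pair_tiesAway_fixed`)
and under round-to-even the input pair is returned unchanged (`compress_pair_roundTiesEven`) —
both by the tree's characterisation of incompressible pairs, `compress_pair_eq_self_iff`.

MECHANISM (one tie, met twice; everything else is exact).  `Q = 2^p·2^e₀` is a power of two
of the binade whose grid step is `2^(e₀+1)`; `Q + 2^e₀` is the MIDPOINT of the consecutive
floats `Q` and `Q + 2^(e₀+1)`, and ties-to-away resolves it UPWARDS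
(`fl_midpoint_of_tiesAway_nonneg`), so FAST-TWO-SUM(Q, 2^e₀) = (Q + 2·2^e₀, −2^e₀): the
downward sweep emits `g = Q + 2^(e₀+1)` with carry `−2^e₀`, and the upward sweep meets the
same sum `g − 2^e₀ = Q + 2^e₀`, the same tie, and emits `h = ⟨−2^e₀, Q + 2^(e₀+1)⟩`.
Round-to-even sends the midpoint DOWN to the even neighbour `Q`
(`MullerRideau2022.roundTiesEven_midpoint`), both sweeps are exact no-ops, `⟨2^e₀, Q⟩` stays.

ALSO RECORDED: non-vacuity of the hypothesis class — for every format there IS a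
round-to-nearest map with the ties-to-away attribute (`exists_isRoundNearest_tiesAway`:
re-break every tie of round-to-even towards the candidate of larger magnitude); the tree's
`PredSucc.theorem_2_tiesAway` and `CompressRelativeErrorTiesAway(Family)` assume such a map.

HONEST FRAMING.  Shewchuk states nonadjacency only for round-to-even, so nothing here
contradicts the paper; what is shown is that the restriction is necessary (the any-tie-rule
part of the tree's Theorem 23, `IsExpansion 1`, is all one can have for ties-to-away), with a
two-component witness in every precision and binade.  Reference check (integer model of
COMPRESS, not part of the formal content; `p = 2, 3, 4, 5`, inputs of two or three components):
`2^p` is the least height (largest component) of a nonadjacent input whose ties-to-away output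
is adjacent, attained by `⟨1, 2^p⟩` (for `p ≥ 4` also by `⟨5, 2^p⟩`, `⟨1, 4, 2^p⟩`, …).
-/

namespace Summit.Ventures.CertifiedArithmetic.Expansions

open Literature.ComputerArithmetic.JeannerodRump2018
open Literature.ComputerArithmetic.BoldoJeannerodMelquiondMuller2023 hiding twoSum twoSum_fst
open Literature.ComputerArithmetic.RumpOgitaOishi2008 (IsSucc)
open Literature.ComputerArithmetic.RumpZimmermannBoldoMelquiond2009 (IsTiesAway
  fl_midpoint_of_tiesAway_nonneg)
open Literature.ComputerArithmetic.MullerRideau2022 (roundTiesEven_midpoint)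
open Literature.ComputerArithmetic.Shewchuk1997

variable {p : ℕ} {emin : ℤ} {fl : ℚ → ℚ}

/-! ### Replaying COMPRESS on a pair -/

/-- COMPRESS on the pair `⟨W, P·W⟩` (smallest first) when the sum `(P + 1)·W` is rounded UP to
`(P + 2)·W` and `0`, `−W`, `2W` are fixed by `fl`: the downward sweep computes
FAST-TWO-SUM(P·W, W) = ((P+2)·W, −W) and emits `(P+2)·W`; the upward sweep computes
FAST-TWO-SUM((P+2)·W, −W) = ((P+2)·W, −W) and emits `−W`; the result is `⟨−W, (P+2)·W⟩`.
[cite: Shewchuk1997, §2.7 p. 332 (COMPRESS), §2.3 Theorem 6 (FAST-TWO-SUM)] -/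
theorem compress_pair_of_tie_up {fl : ℚ → ℚ} {P W : ℚ} (h0 : fl 0 = 0) (hW : fl (-W) = -W)
    (h2W : fl (2 * W) = 2 * W) (htie : fl ((P + 1) * W) = (P + 2) * W) (hW0 : W ≠ 0) :
    compress fl [W, P * W] = [-W, (P + 2) * W] := by
  have hA : fastTwoSum fl (P * W) W = ((P + 2) * W, -W) := by
    simp only [fastTwoSum]
    rw [show P * W + W = (P + 1) * W by ring, htie, show (P + 2) * W - P * W = 2 * W by ring,
      h2W, show W - 2 * W = -W by ring, hW]
  have hB : fastTwoSum fl ((P + 2) * W) (-W) = ((P + 2) * W, -W) := by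
    simp only [fastTwoSum]
    rw [show (P + 2) * W + -W = (P + 1) * W by ring, htie, sub_self, h0, sub_zero, hW]
  have hW' : -W ≠ 0 := neg_ne_zero.mpr hW0
  simp [compress, compressDown, compressUp, hA, hB, hW']

/-! ### The floats `2^e₀`, `2^p·2^e₀`, `(2^p + 2)·2^e₀` and the tie between the last two -/

/-- `2^(e₀ + n) = 2^n · 2^e₀` for a natural `n`. [cite: BoldoEtAl2023, §2.1] -/
theorem two_zpow_add_natCast_eq (e₀ : ℤ) (n : ℕ) :
    (2 : ℚ) ^ (e₀ + (n : ℤ)) = 2 ^ n * (2 : ℚ) ^ e₀ := by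
  rw [zpow_add₀ (by norm_num : (2 : ℚ) ≠ 0), zpow_natCast]; ring

/-- The five floats of `F(p, emin)` met by the computation (`p ≥ 2`, `e₀ ≥ emin`): `W = 2^e₀`,
`−W`, `2W`, `2^p·W` and `(2^p + 2)·W = (2^(p−1) + 1)·2^(e₀+1)`.
[cite: JeannerodRump2018, §1 (F); BoldoEtAl2023, §2.1] -/
theorem pair_tiesAway_isFloat (hp : 2 ≤ p) {e₀ : ℤ} (he : emin ≤ e₀) :
    IsFloat p emin ((2 : ℚ) ^ e₀) ∧ IsFloat p emin (-(2 : ℚ) ^ e₀) ∧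
      IsFloat p emin (2 * (2 : ℚ) ^ e₀) ∧ IsFloat p emin (2 ^ p * (2 : ℚ) ^ e₀) ∧
      IsFloat p emin ((2 ^ p + 2) * (2 : ℚ) ^ e₀) := by
  obtain ⟨q, rfl⟩ : ∃ q, p = q + 1 := ⟨p - 1, by omega⟩
  have hq : 1 ≤ q := by omega
  have h2q : (2 : ℤ) ≤ 2 ^ q := by
    calc (2 : ℤ) = 2 ^ 1 := (pow_one 2).symm
      _ ≤ 2 ^ q := pow_le_pow_right₀ (by norm_num) hq
  have h1 : |(1 : ℤ)| < 2 ^ (q + 1) := by rw [abs_one, pow_succ]; linarith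
  refine ⟨⟨1, e₀, h1, he, by simp⟩, ⟨-1, e₀, by rw [abs_neg]; exact h1, he, by simp⟩,
    ⟨1, e₀ + ((1 : ℕ) : ℤ), h1, by push_cast; omega,
      by rw [two_zpow_add_natCast_eq]; ring⟩,
    ⟨1, e₀ + ((q + 1 : ℕ) : ℤ), h1, by push_cast; omega,
      by rw [two_zpow_add_natCast_eq]; ring⟩,
    ⟨2 ^ q + 1, e₀ + ((1 : ℕ) : ℤ), by rw [abs_of_pos (by positivity), pow_succ]; linarith,
      by push_cast; omega, by rw [two_zpow_add_natCast_eq]; push_cast; ring⟩⟩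

/-- `(2^p + 2)·2^e₀` is the float successor of `2^p·2^e₀` (`p ≥ 2`, `e₀ ≥ emin`): every float
above `2^p·2^e₀ = 2^(e₀+p)` is a multiple of the grid step `2^(e₀+1)` of that binade.
[cite: BoldoEtAl2023, §2.1 (p. 214: a float of magnitude ≥ 2^E is a multiple of 2^(E−p+1));
RumpOgitaOishi2008, §2 (succ)] -/
theorem isSucc_two_pow_mul_tiesAway_pair (hp : 2 ≤ p) {e₀ : ℤ} (he : emin ≤ e₀) :
    IsSucc p emin (2 ^ p * (2 : ℚ) ^ e₀) ((2 ^ p + 2) * (2 : ℚ) ^ e₀) := by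
  obtain ⟨-, -, -, -, F5⟩ := pair_tiesAway_isFloat hp he
  have hW : (0 : ℚ) < (2 : ℚ) ^ e₀ := zpow_pos (by norm_num) _
  refine ⟨F5, by nlinarith, fun h hh hlt => ?_⟩
  obtain ⟨q, rfl⟩ : ∃ q, p = q + 1 := ⟨p - 1, by omega⟩
  have hE : (2 : ℚ) ^ (e₀ + ((q + 1 : ℕ) : ℤ)) ≤ |h| := by
    rw [two_zpow_add_natCast_eq]; exact le_trans hlt.le (le_abs_self h)
  obtain ⟨K, hK⟩ := exists_eq_int_mul_two_zpow_of_isFloat hh hE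
  rw [show e₀ + ((q + 1 : ℕ) : ℤ) - ((q + 1 : ℕ) : ℤ) + 1 = e₀ + ((1 : ℕ) : ℤ) by ring,
    two_zpow_add_natCast_eq, pow_one] at hK
  -- `2^q·(2·2^e₀) < K·(2·2^e₀)` forces `2^q + 1 ≤ K`
  have h1 : ((2 ^ q : ℤ) : ℚ) * (2 * (2 : ℚ) ^ e₀) < (K : ℚ) * (2 * (2 : ℚ) ^ e₀) := by
    rw [← hK]; push_cast; rw [pow_succ] at hlt; linarith
  have h2 : (2 ^ q : ℤ) < K := by exact_mod_cast lt_of_mul_lt_mul_right h1 (by positivity)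
  have h3 : ((2 ^ q : ℤ) : ℚ) + 1 ≤ (K : ℚ) := by exact_mod_cast h2
  rw [hK]; push_cast at h3 ⊢; rw [pow_succ]; nlinarith

/-- THE TIE: a round-to-nearest `fl` with the ties-to-away attribute sends `(2^p + 1)·2^e₀`,
the midpoint of the consecutive floats `2^p·2^e₀ < (2^p + 2)·2^e₀`, to the one of larger
magnitude. [cite: RumpZimmermannBoldoMelquiond2009, §2.2 ("'ties to away' as defined by
IEEE 754-2008"); BoldoEtAl2023, §2.2 (RN_a)] -/
theorem fl_tie_of_tiesAway_pair (hp : 2 ≤ p) {e₀ : ℤ} (he : emin ≤ e₀)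
    (hfl : IsRoundNearest p emin fl) (haway : IsTiesAway p emin fl) :
    fl ((2 ^ p + 1) * (2 : ℚ) ^ e₀) = (2 ^ p + 2) * (2 : ℚ) ^ e₀ := by
  obtain ⟨-, -, -, F4, -⟩ := pair_tiesAway_isFloat hp he
  have h0 : (0 : ℚ) ≤ 2 ^ p * (2 : ℚ) ^ e₀ :=
    mul_nonneg (pow_nonneg (by norm_num) _) (zpow_nonneg (by norm_num) _)
  have h := fl_midpoint_of_tiesAway_nonneg hfl haway F4
    (isSucc_two_pow_mul_tiesAway_pair hp he) h0
  rwa [show ((2 : ℚ) ^ p * 2 ^ e₀ + (2 ^ p + 2) * 2 ^ e₀) / 2 = (2 ^ p + 1) * 2 ^ e₀ by ring]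
    at h

/-- Round-to-EVEN sends the same midpoint DOWN: `2^p·2^e₀ = 2^(p−1)·2^(e₀+1)` has the even
significand. [cite: BoldoEtAl2023, §2.2 (ties-to-even); MullerRideau2022, §2.2] -/
theorem roundTiesEven_tie_pair (hp : 2 ≤ p) {e₀ : ℤ} (he : emin ≤ e₀) :
    roundTiesEven p emin ((2 ^ p + 1) * (2 : ℚ) ^ e₀) = 2 ^ p * (2 : ℚ) ^ e₀ := by
  obtain ⟨q, rfl⟩ : ∃ q, p = q + 1 := ⟨p - 1, by omega⟩
  have hq : 1 ≤ q := by omega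
  have h2q : (2 : ℤ) ≤ 2 ^ q := by
    calc (2 : ℤ) = 2 ^ 1 := (pow_one 2).symm
      _ ≤ 2 ^ q := pow_le_pow_right₀ (by norm_num) hq
  have hev : Even ((2 : ℤ) ^ q) := Int.even_pow.mpr ⟨even_two, by omega⟩
  have h := roundTiesEven_midpoint (p := q + 1) (emin := emin) (M := 2 ^ q) (e := e₀ + 1)
    (by omega) (by simp) (by rw [pow_succ]; linarith) (by omega)
  rw [if_pos hev, zpow_add₀ (by norm_num : (2 : ℚ) ≠ 0), zpow_one] at h
  push_cast at h
  rw [show (((2 : ℚ) ^ q + 1 / 2)) * (2 ^ e₀ * 2) = (2 ^ (q + 1) + 1) * 2 ^ e₀ by ring] at h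
  rw [h]; ring

/-! ### The gaps: nonadjacent input, adjacent output -/

/-- The INPUT `⟨2^e₀, 2^p·2^e₀⟩` is a nonadjacent expansion (`p ≥ 2`): `2^p·2^e₀` lies on the
grid `2^(e₀+p)` and `2·2^e₀ < 2^(e₀+p)`. [cite: Shewchuk1997, §2.1 p. 309 (nonadjacent)] -/
theorem pair_tiesAway_input_isExpansion_two (hp : 2 ≤ p) (e₀ : ℤ) :
    IsExpansion 2 [(2 : ℚ) ^ e₀, 2 ^ p * (2 : ℚ) ^ e₀] := by
  have hW : (0 : ℚ) < (2 : ℚ) ^ e₀ := zpow_pos (by norm_num) _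
  have h4 : (4 : ℚ) ≤ 2 ^ p := by
    calc (4 : ℚ) = 2 ^ 2 := by norm_num
      _ ≤ 2 ^ p := pow_le_pow_right₀ (by norm_num) hp
  refine List.Pairwise.cons ?_ (List.pairwise_singleton _ _)
  intro y hy
  rw [List.mem_singleton] at hy
  subst hy
  refine ⟨e₀ + (p : ℤ), ⟨1, by rw [two_zpow_add_natCast_eq]; simp⟩, ?_⟩
  rw [two_zpow_add_natCast_eq, abs_of_pos hW]
  nlinarith

/-- The OUTPUT `⟨−2^e₀, (2^p + 2)·2^e₀⟩` is a nonoverlapping expansion (`p ≥ 1`):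
`(2^p + 2)·2^e₀` lies on the grid `2^(e₀+1)` and `|−2^e₀| < 2^(e₀+1)`.
[cite: Shewchuk1997, §2.1 p. 309 (nonoverlapping)] -/
theorem pair_tiesAway_output_isExpansion_one (hp : 1 ≤ p) (e₀ : ℤ) :
    IsExpansion 1 [-(2 : ℚ) ^ e₀, (2 ^ p + 2) * (2 : ℚ) ^ e₀] := by
  obtain ⟨q, rfl⟩ : ∃ q, p = q + 1 := ⟨p - 1, by omega⟩
  have hW : (0 : ℚ) < (2 : ℚ) ^ e₀ := zpow_pos (by norm_num) _
  refine List.Pairwise.cons ?_ (List.pairwise_singleton _ _)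
  intro y hy
  rw [List.mem_singleton] at hy
  subst hy
  refine ⟨e₀ + ((1 : ℕ) : ℤ),
    ⟨2 ^ q + 1, by rw [two_zpow_add_natCast_eq]; push_cast; ring⟩, ?_⟩
  rw [two_zpow_add_natCast_eq, abs_neg, abs_of_pos hW]; linarith

/-- The OUTPUT is ADJACENT (`p ≥ 2`): `(2^p + 2)·2^e₀ = (2^(p−1) + 1)·2^(e₀+1)` with an ODD
significand, so every grid `2^s` carrying it has `s ≤ e₀ + 1` (`OnGrid.le_of_odd`), while the
nonadjacent gap would need `2·2^e₀ < 2^s`.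
[cite: Shewchuk1997, §2.1 p. 309 (adjacent: "2x overlaps y")] -/
theorem not_below_two_tiesAway_output (hp : 2 ≤ p) (e₀ : ℤ) :
    ¬ Below 2 (-(2 : ℚ) ^ e₀) ((2 ^ p + 2) * (2 : ℚ) ^ e₀) := by
  obtain ⟨q, rfl⟩ : ∃ q, p = q + 1 := ⟨p - 1, by omega⟩
  have hW : (0 : ℚ) < (2 : ℚ) ^ e₀ := zpow_pos (by norm_num) _
  rintro ⟨s, hs, hlt⟩
  have hodd : Odd ((2 : ℤ) ^ q + 1) := (Int.even_pow.mpr ⟨even_two, by omega⟩).add_one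
  have hrepr : ((2 : ℚ) ^ (q + 1) + 2) * (2 : ℚ) ^ e₀ =
      (((2 ^ q + 1 : ℤ)) : ℚ) * (2 : ℚ) ^ (e₀ + 1) := by
    rw [zpow_add₀ (by norm_num : (2 : ℚ) ≠ 0), zpow_one]; push_cast; ring
  rw [hrepr] at hs
  have hs1 : s ≤ e₀ + 1 := OnGrid.le_of_odd hodd hs
  have h2s : (2 : ℚ) ^ s ≤ (2 : ℚ) ^ (e₀ + 1) := zpow_le_zpow_right₀ (by norm_num) hs1
  rw [abs_neg, abs_of_pos hW] at hlt
  rw [zpow_add₀ (by norm_num : (2 : ℚ) ≠ 0), zpow_one] at h2s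
  linarith

/-- Hence the output is NOT a nonadjacent expansion …
[cite: Shewchuk1997, §2.1 p. 309; Thm 23 p. 331] -/
theorem pair_tiesAway_output_not_isExpansion_two (hp : 2 ≤ p) (e₀ : ℤ) :
    ¬ IsExpansion 2 [-(2 : ℚ) ^ e₀, (2 ^ p + 2) * (2 : ℚ) ^ e₀] := by
  intro h
  have h' := List.pairwise_cons.mp h
  exact not_below_two_tiesAway_output hp e₀ (h'.1 _ (List.mem_singleton_self _))

/-- … and, in the words of §2.1, its two components are ADJACENT (`2·(−2^e₀)` overlaps
`(2^p + 2)·2^e₀`): by the dictionary `below_two_iff`, nonadjacent components ordered by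
magnitude would lie 2-below each other. [cite: Shewchuk1997, §2.1 p. 309 (adjacent)] -/
theorem pair_tiesAway_output_not_nonadjacent (hp : 2 ≤ p) {e₀ : ℤ} (he : emin ≤ e₀) :
    ¬ Nonadjacent (-(2 : ℚ) ^ e₀) ((2 ^ p + 2) * (2 : ℚ) ^ e₀) := by
  intro hna
  obtain ⟨-, -, -, -, F5⟩ := pair_tiesAway_isFloat hp he
  have hW : (0 : ℚ) < (2 : ℚ) ^ e₀ := zpow_pos (by norm_num) _
  have hlt : |(-(2 : ℚ) ^ e₀)| < |(2 ^ p + 2) * (2 : ℚ) ^ e₀| := by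
    rw [abs_neg, abs_of_pos hW, abs_of_pos (by positivity)]
    have : (1 : ℚ) ≤ 2 ^ p := one_le_pow₀ (by norm_num)
    nlinarith
  exact not_below_two_tiesAway_output hp e₀
    ((below_two_iff F5).mpr ⟨hna, Or.inr (Or.inr hlt)⟩)

/-! ### The statements -/

/-- **COMPRESS under ties-to-away on `⟨2^e₀, 2^p·2^e₀⟩`** (`p ≥ 2`, `e₀ ≥ emin`, any
round-to-nearest `fl` on `F(p, emin)` with the IEEE 754-2008 ties-to-away attribute): the
result is `⟨−2^e₀, (2^p + 2)·2^e₀⟩`. [cite: Shewchuk1997, §2.7 p. 332 (COMPRESS), Thm 23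
p. 331; RumpZimmermannBoldoMelquiond2009, §2.2; BoldoEtAl2023, §2.2 (RN_a)] -/
theorem compress_pair_tiesAway (hp : 2 ≤ p) {e₀ : ℤ} (he : emin ≤ e₀)
    (hfl : IsRoundNearest p emin fl) (haway : IsTiesAway p emin fl) :
    compress fl [(2 : ℚ) ^ e₀, 2 ^ p * (2 : ℚ) ^ e₀] =
      [-(2 : ℚ) ^ e₀, (2 ^ p + 2) * (2 : ℚ) ^ e₀] := by
  obtain ⟨-, F2, F3, -, -⟩ := pair_tiesAway_isFloat hp he
  exact compress_pair_of_tie_up (fl_zero hfl) (fl_eq_self hfl F2) (fl_eq_self hfl F3)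
    (fl_tie_of_tiesAway_pair hp he hfl haway) (zpow_pos (by norm_num) _).ne'

/-- **The output pair is a fixed point of COMPRESS under ties-to-away** (an ADJACENT fixed
point): by the tree's characterisation of the incompressible pairs (`compress_pair_eq_self_iff`:
the larger absorbs the smaller, `fl((2^p + 2)·2^e₀ − 2^e₀) = (2^p + 2)·2^e₀` — the same tie).
[cite: Shewchuk1997, §2.7 p. 332 (COMPRESS); RumpZimmermannBoldoMelquiond2009, §2.2] -/
theorem compress_pair_tiesAway_fixed (hp : 2 ≤ p) {e₀ : ℤ} (he : emin ≤ e₀)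
    (hfl : IsRoundNearest p emin fl) (haway : IsTiesAway p emin fl) :
    compress fl [-(2 : ℚ) ^ e₀, (2 ^ p + 2) * (2 : ℚ) ^ e₀] =
      [-(2 : ℚ) ^ e₀, (2 ^ p + 2) * (2 : ℚ) ^ e₀] := by
  obtain ⟨-, F2, -, -, F5⟩ := pair_tiesAway_isFloat hp he
  have hW : (0 : ℚ) < (2 : ℚ) ^ e₀ := zpow_pos (by norm_num) _
  have hle : |(-(2 : ℚ) ^ e₀)| ≤ |(2 ^ p + 2) * (2 : ℚ) ^ e₀| := by
    rw [abs_neg, abs_of_pos hW, abs_of_pos (by positivity)]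
    have : (1 : ℚ) ≤ 2 ^ p := one_le_pow₀ (by norm_num)
    nlinarith
  refine (compress_pair_eq_self_iff (le_trans (by norm_num) hp) hfl F2 F5 hle).mpr ⟨?_, ?_⟩
  · rw [show (2 ^ p + 2) * (2 : ℚ) ^ e₀ + -(2 : ℚ) ^ e₀ = (2 ^ p + 1) * (2 : ℚ) ^ e₀ by ring]
    exact fl_tie_of_tiesAway_pair hp he hfl haway
  · exact neg_ne_zero.mpr hW.ne'

/-- **Under round-to-even the same input is returned unchanged** (and it is nonadjacent).
[cite: Shewchuk1997, §2.7 p. 332 (COMPRESS), Thm 23 p. 331, Cor 9 p. 315;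
BoldoEtAl2023, §2.2 (ties-to-even)] -/
theorem compress_pair_roundTiesEven (hp : 2 ≤ p) {e₀ : ℤ} (he : emin ≤ e₀) :
    compress (roundTiesEven p emin) [(2 : ℚ) ^ e₀, 2 ^ p * (2 : ℚ) ^ e₀] =
      [(2 : ℚ) ^ e₀, 2 ^ p * (2 : ℚ) ^ e₀] := by
  have hp1 : 1 ≤ p := le_trans (by norm_num) hp
  obtain ⟨F1, -, -, F4, -⟩ := pair_tiesAway_isFloat hp he
  have hW : (0 : ℚ) < (2 : ℚ) ^ e₀ := zpow_pos (by norm_num) _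
  have hle : |(2 : ℚ) ^ e₀| ≤ |2 ^ p * (2 : ℚ) ^ e₀| := by
    rw [abs_of_pos hW, abs_of_pos (by positivity)]
    have : (1 : ℚ) ≤ 2 ^ p := one_le_pow₀ (by norm_num)
    nlinarith
  refine (compress_pair_eq_self_iff hp1 (isRoundNearest_roundTiesEven hp1) F1 F4 hle).mpr
    ⟨?_, hW.ne'⟩
  rw [show 2 ^ p * (2 : ℚ) ^ e₀ + (2 : ℚ) ^ e₀ = (2 ^ p + 1) * (2 : ℚ) ^ e₀ by ring]
  exact roundTiesEven_tie_pair hp he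

/-- **THEOREM 23's "(nonadjacent if round-to-even is used)" IS SHARP IN THE TIE RULE.**  For
every precision `p ≥ 2`, every `e₀ ≥ emin` and every round-to-nearest `fl` on `F(p, emin)` with
the ties-to-away attribute: the input `e = ⟨2^e₀, 2^p·2^e₀⟩` consists of floats and is a
nonoverlapping, indeed NONADJACENT, expansion; `h = COMPRESS(e) = ⟨−2^e₀, (2^p + 2)·2^e₀⟩` is a
nonoverlapping expansion (Theorem 23, any tie rule) which is NOT nonadjacent — its two
components are adjacent. [cite: Shewchuk1997, Thm 23 p. 331 ("nonadjacent if round-to-even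
tiebreaking is used"), §2.1 p. 309; RumpZimmermannBoldoMelquiond2009, §2.2 ("'ties to away'
as defined by IEEE 754-2008")] -/
theorem compress_tiesAway_adjacent (hp : 2 ≤ p) {e₀ : ℤ} (he : emin ≤ e₀)
    (hfl : IsRoundNearest p emin fl) (haway : IsTiesAway p emin fl) :
    (∀ x ∈ [(2 : ℚ) ^ e₀, 2 ^ p * (2 : ℚ) ^ e₀], IsFloat p emin x) ∧
      IsExpansion 2 [(2 : ℚ) ^ e₀, 2 ^ p * (2 : ℚ) ^ e₀] ∧
      IsExpansion 1 (compress fl [(2 : ℚ) ^ e₀, 2 ^ p * (2 : ℚ) ^ e₀]) ∧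
      ¬ IsExpansion 2 (compress fl [(2 : ℚ) ^ e₀, 2 ^ p * (2 : ℚ) ^ e₀]) ∧
      ∀ x y : ℚ, compress fl [(2 : ℚ) ^ e₀, 2 ^ p * (2 : ℚ) ^ e₀] = [x, y] →
        ¬ Nonadjacent x y := by
  obtain ⟨F1, -, -, F4, -⟩ := pair_tiesAway_isFloat hp he
  rw [compress_pair_tiesAway hp he hfl haway]
  refine ⟨?_, pair_tiesAway_input_isExpansion_two hp e₀,
    pair_tiesAway_output_isExpansion_one (le_trans (by norm_num) hp) e₀,
    pair_tiesAway_output_not_isExpansion_two hp e₀, fun x y hxy => ?_⟩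
  · intro x hx
    simp only [List.mem_cons, List.mem_nil_iff, or_false] at hx
    rcases hx with rfl | rfl
    exacts [F1, F4]
  · simp only [List.cons.injEq, and_true] at hxy
    obtain ⟨rfl, rfl⟩ := hxy
    exact pair_tiesAway_output_not_nonadjacent hp he

/-- The smallest instance, `p = 3`, `e₀ = emin = 0`: COMPRESS`⟨1, 8⟩ = ⟨−1, 10⟩` under
ties-to-away on `F(3, 0)` (`fl 9 = 10`), while round-to-even (`fl 9 = 8`) returns `⟨1, 8⟩`.
[cite: Shewchuk1997, §2.7 p. 332 (COMPRESS)] -/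
example (hfl : IsRoundNearest 3 0 fl) (haway : IsTiesAway 3 0 fl) :
    compress fl [1, 8] = [-1, 10] ∧ compress (roundTiesEven 3 0) [1, 8] = [1, 8] := by
  have h1 := compress_pair_tiesAway (p := 3) (e₀ := 0) (by norm_num) le_rfl hfl haway
  have h2 := compress_pair_roundTiesEven (p := 3) (emin := 0) (e₀ := 0) (by norm_num) le_rfl
  norm_num at h1 h2
  exact ⟨h1, h2⟩

/-! ### Non-vacuity: ties-to-away nearest roundings exist in every format -/

/-- **There IS a round-to-nearest map with the ties-to-away attribute** on every `F(p, emin)`,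
`p ≥ 1`: take round-to-even and re-break each tie towards the candidate of larger magnitude
(the mirror image `2t − RN(t)` of `RN(t)` in `t`, whenever that is a float of larger
magnitude; a float as near to `t` as `RN(t)` is `RN(t)` or that mirror image) — the mirror
construction of the venture's `LowPrec.OptChainLabelsTiesAway.exists_roundNearest_tiesUp`
(ties UPWARD, `f ≤ fl t`) with the magnitude comparison `|f| ≤ |fl t|` in its place.
[cite: BoldoEtAl2023, §2.2 (RN_a: "the one with largest magnitude");
RumpZimmermannBoldoMelquiond2009, §2.2] -/
theorem exists_isRoundNearest_tiesAway (hp : 1 ≤ p) (emin : ℤ) :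
    ∃ fl : ℚ → ℚ, IsRoundNearest p emin fl ∧ IsTiesAway p emin fl := by
  classical
  set f : ℚ → ℚ := roundTiesEven p emin with hf
  have hRN : IsRoundNearest p emin f := isRoundNearest_roundTiesEven hp
  refine ⟨fun t =>
    if IsFloat p emin (2 * t - f t) ∧ |f t| ≤ |2 * t - f t| then 2 * t - f t else f t,
    fun t => ?_, fun t g hg heq => ?_⟩
  · by_cases h : IsFloat p emin (2 * t - f t) ∧ |f t| ≤ |2 * t - f t|
    · simp only [if_pos h]
      refine ⟨h.1, fun g hg => ?_⟩
      rw [show t - (2 * t - f t) = -(t - f t) by ring, abs_neg]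
      exact (hRN t).2 g hg
    · simp only [if_neg h]
      exact hRN t
  · by_cases h : IsFloat p emin (2 * t - f t) ∧ |f t| ≤ |2 * t - f t|
    · simp only [if_pos h] at heq ⊢
      rw [show t - (2 * t - f t) = -(t - f t) by ring, abs_neg] at heq
      rcases abs_eq_abs.mp heq with h1 | h1
      · rw [show g = f t by linarith]; exact h.2
      · rw [show g = 2 * t - f t by linarith]
    · simp only [if_neg h] at heq ⊢
      rcases abs_eq_abs.mp heq with h1 | h1
      · rw [show g = f t by linarith]
      · have hg' : g = 2 * t - f t := by linarith
        subst hg'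
        by_contra hlt
        exact h ⟨hg, (not_le.mp hlt).le⟩

end Summit.Ventures.CertifiedArithmetic.Expansions
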